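import Summits.QuantumFields.YangMills.Theorems.F4SubCurvatureDoorShortRootRigidityPlanarRigidity
import Mathlib
import HarnessLib

/-!
# Rung R1 «HERMITIAN CONE» of SUB-LINE g22-A «HERMITIAN SLICE» — unfolded over the tree vocabulary
# (planner ym-idea-3 g22; crux ⟨stmt-QuantumFields-23035⟩ `F4SubCurvatureDoor.ShortRootRigidity`, registered stub `:146 stub_oddModeRigidity`;
# typed rungs `Cruxes/ShortRootRigidity/Lines/hermitian_slice_rungs.lean` fdd8f4dcefd5, rung `HermitianCone`)

Free-hands work of the EXTRA WIDTH seat ym-line-sfw-p2-w4 (gen 25).  The rung says: the frame Laplace–Fourier measure `μ` of a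
Hermitian planar kernel `k : ℝ² → ℂ` (complex form `k(t,x) = ∫ e^{−tE} e^{ixp} dμ(E,p)` for `t > 0`) is carried by the forward light
cone, `μ {E < |p|} = 0` (`HasAperture μ 1`).  Route (the rungs file's docstring): the REAL PART `Re ∘ k` is a kernel of the real planar
class ✓`InPlanarClass` with the SAME frame measure (✓`IsPlanarLF (Re ∘ k) μ`), so ✓`planarConeSupport_holds` applies.  The two
conjuncts of `InPlanarClass` that are not hypotheses of the Hermitian class are READ OFF the complex representation:

* `Re k (mk2 t x) = ∫ e^{−tE} cos (xp) dμ` (`re_apply_mk2`: real part under the integral sign), hence `Re k (t, −x) = Re k (t, x)` for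
  `t > 0`; with `−(t, x) = θ₂ (t, −x)` and `θ₂`-invariance this is EVENNESS off the mirror, and on the mirror `t = 0` evenness follows by
  continuity of `k` off `0` along `t ↦ (t, x)`, `t ↓ 0` (`re_neg`);
* REAL REFLECTION POSITIVITY (`re_reflectionPositive`): for `tᵢ > 0`, `θ₂ yᵢ − yⱼ = θ₂ (tᵢ + tⱼ, xᵢ − xⱼ)`, so
  `Σ cᵢcⱼ Re k(θ₂yᵢ − yⱼ) = ∫ [(Σ cᵢ e^{−tᵢE} cos (xᵢp))² + (Σ cᵢ e^{−tᵢE} sin (xᵢp))²] dμ ≥ 0`.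

`hermitianCone_unfolded` is the rung `HermitianCone` with `InHermitianPlanarClass` / `IsHermitianPlanarLF` unfolded (the Cruxes file is
not importable); the by-name wrapper follows in a separate file over the registered vocabulary module.
HONEST LABEL: one routine rung (S–M) of an INSURANCE sub-line (g22-A, PASS tier B, unstaffed by design) for `:146`; the load-bearing rungs
R2/R4, `:146`, ⟨23035⟩, ⟨23125⟩ and R2d are untouched; no crux, ladder rung, leaf or summit is proved; the Yang–Mills mass gap is NOT
proved by this.
-/

noncomputable section

namespace Summit.QuantumFields.YangMills.Theorems.F4SubCurvatureDoorHermitianCone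

open scoped Topology BigOperators RealInnerProductSpace
open Filter Set MeasureTheory
open Literature.MathematicalPhysics.QuantumLattice (timeReflection timeReflection_apply)
open Summit.QuantumFields.YangMills.Theorems.F4SubCurvatureDoorSliceDensityRegistered (E2)
open Summit.QuantumFields.YangMills.Theorems.F4SubCurvatureDoorSliceInClassRegistered (hexReflection InPlanarClass)
open Summit.QuantumFields.YangMills.Theorems.F4SubCurvatureDoorPlanarFrameTimeHolomorphyRegistered (mk2)
open Summit.QuantumFields.YangMills.Theorems.F4SubCurvatureDoorPlanarInitialApertureRegistered (IsPlanarLF HasAperture)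
open Summit.QuantumFields.YangMills.Theorems.F4SubCurvatureDoorPlanarConeSupportByName (planarConeSupport_holds)

variable {k : E2 → ℂ} {μ : Measure (ℝ × ℝ)}

/-! ## Planar bookkeeping for `mk2` (the registered frame-coordinates map of `IsPlanarLF`) -/

/-- `−(t, x) = θ₂ (t, −x)`. -/
theorem neg_eq_timeReflection_mk2 (y : E2) : -y = timeReflection 2 (mk2 (y 0) (-(y 1))) := by
  ext i; fin_cases i <;> simp [timeReflection_apply, mk2]

/-- `θ₂ y − y' = θ₂ (y₀ + y'₀, y₁ − y'₁)`. -/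
theorem timeReflection_sub_eq (y y' : E2) :
    timeReflection 2 y - y' = timeReflection 2 (mk2 (y 0 + y' 0) (y 1 - y' 1)) := by
  ext i; fin_cases i
  · simp [timeReflection_apply, mk2]; ring
  · simp [timeReflection_apply, mk2]

/-- Continuity of `t ↦ (t, x)`. -/
theorem continuous_mk2_left (x : ℝ) : Continuous fun t : ℝ => mk2 t x := by
  have h : (fun t : ℝ => mk2 t x) = fun t => t • (EuclideanSpace.single 0 (1 : ℝ) : E2) + mk2 0 x := by
    funext t; ext i; fin_cases i <;> simp [mk2]
  rw [h]
  fun_prop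

/-! ## The complex frame representation and its real part -/

/-- For `t` with `e^{−tE}` integrable, the complex integrand `e^{−tE} e^{ixp}` is integrable. -/
theorem integrable_frameIntegrand {t : ℝ} (hint : Integrable (fun z : ℝ × ℝ => Real.exp (-(t * z.1))) μ) (x : ℝ) :
    Integrable (fun z : ℝ × ℝ => ((Real.exp (-(z.1 * t)) : ℝ) : ℂ) * Complex.exp (((z.2 * x : ℝ) : ℂ) * Complex.I)) μ := by
  have hint' : Integrable (fun z : ℝ × ℝ => Real.exp (-(z.1 * t))) μ :=
    hint.congr (ae_of_all _ fun z => by simp only [mul_comm])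
  refine hint'.mono' (by fun_prop) (ae_of_all _ fun z => ?_)
  rw [norm_mul, Complex.norm_exp_ofReal_mul_I, mul_one, Complex.norm_real, Real.norm_eq_abs,
    abs_of_pos (Real.exp_pos _)]

/-- **Real part under the integral sign**: `Re k (t, x) = ∫ e^{−tE} cos (xp) dμ` for `t > 0`. -/
theorem re_apply_mk2
    (hLF : ∀ t : ℝ, 0 < t → Integrable (fun z : ℝ × ℝ => Real.exp (-(t * z.1))) μ ∧
      ∀ x : ℝ, k (mk2 t x) = ∫ z, ((Real.exp (-(z.1 * t)) : ℝ) : ℂ) * Complex.exp (((z.2 * x : ℝ) : ℂ) * Complex.I) ∂μ)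
    {t : ℝ} (ht : 0 < t) (x : ℝ) :
    (k (mk2 t x)).re = ∫ z, Real.exp (-(z.1 * t)) * Real.cos (z.2 * x) ∂μ := by
  obtain ⟨hint, hrep⟩ := hLF t ht
  rw [hrep x]
  have h := integral_re (integrable_frameIntegrand hint x)
  simp only [RCLike.re_to_complex] at h
  rw [← h]
  refine integral_congr_ae (ae_of_all _ fun z => ?_)
  dsimp only
  rw [Complex.re_ofReal_mul, Complex.exp_ofReal_mul_I_re]

/-- The SAME `μ` represents `Re ∘ k` in the real planar Laplace–Fourier form ✓`IsPlanarLF`. -/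
theorem re_isPlanarLF (hμ0 : μ (Set.Iio 0 ×ˢ Set.univ) = 0)
    (hLF : ∀ t : ℝ, 0 < t → Integrable (fun z : ℝ × ℝ => Real.exp (-(t * z.1))) μ ∧
      ∀ x : ℝ, k (mk2 t x) = ∫ z, ((Real.exp (-(z.1 * t)) : ℝ) : ℂ) * Complex.exp (((z.2 * x : ℝ) : ℂ) * Complex.I) ∂μ) :
    IsPlanarLF (fun y => (k y).re) μ :=
  ⟨hμ0, fun t ht => ⟨(hLF t ht).1, fun x => re_apply_mk2 hLF ht x⟩⟩

/-! ## Evenness of the real part -/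

/-- `Re k (t, −x) = Re k (t, x)` for `t > 0` (cosine is even). -/
theorem re_mk2_neg
    (hLF : ∀ t : ℝ, 0 < t → Integrable (fun z : ℝ × ℝ => Real.exp (-(t * z.1))) μ ∧
      ∀ x : ℝ, k (mk2 t x) = ∫ z, ((Real.exp (-(z.1 * t)) : ℝ) : ℂ) * Complex.exp (((z.2 * x : ℝ) : ℂ) * Complex.I) ∂μ)
    {t : ℝ} (ht : 0 < t) (x : ℝ) : (k (mk2 t (-x))).re = (k (mk2 t x)).re := by
  rw [re_apply_mk2 hLF ht, re_apply_mk2 hLF ht]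
  refine integral_congr_ae (ae_of_all _ fun z => ?_)
  simp only [mul_neg, Real.cos_neg]

/-- Evenness off the mirror, positive time: `Re k (−y) = Re k y` for `y₀ > 0`. -/
theorem re_neg_of_pos (hθ : ∀ y, k (timeReflection 2 y) = k y)
    (hLF : ∀ t : ℝ, 0 < t → Integrable (fun z : ℝ × ℝ => Real.exp (-(t * z.1))) μ ∧
      ∀ x : ℝ, k (mk2 t x) = ∫ z, ((Real.exp (-(z.1 * t)) : ℝ) : ℂ) * Complex.exp (((z.2 * x : ℝ) : ℂ) * Complex.I) ∂μ)
    {y : E2} (hy : 0 < y 0) : (k (-y)).re = (k y).re := by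
  have heta : mk2 (y 0) (y 1) = y := by ext i; fin_cases i <;> simp [mk2]
  rw [neg_eq_timeReflection_mk2 y, hθ, re_mk2_neg hLF hy, heta]

/-- **Evenness of the real part** everywhere (positive time; negative time by symmetry; the mirror `y₀ = 0` by continuity off `0`). -/
theorem re_neg (hcont : ContinuousOn k {y | y ≠ 0}) (hθ : ∀ y, k (timeReflection 2 y) = k y)
    (hLF : ∀ t : ℝ, 0 < t → Integrable (fun z : ℝ × ℝ => Real.exp (-(t * z.1))) μ ∧
      ∀ x : ℝ, k (mk2 t x) = ∫ z, ((Real.exp (-(z.1 * t)) : ℝ) : ℂ) * Complex.exp (((z.2 * x : ℝ) : ℂ) * Complex.I) ∂μ)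
    (y : E2) : (k (-y)).re = (k y).re := by
  rcases lt_trichotomy 0 (y 0) with hpos | hzero | hneg
  · exact re_neg_of_pos hθ hLF hpos
  · by_cases hy : y = 0
    · subst hy; simp
    · -- on the mirror: limit along `t ↦ (t, x)`, `t ↓ 0`
      set x : ℝ := y 1 with hx
      have heta : mk2 (y 0) (y 1) = y := by ext i; fin_cases i <;> simp [mk2]
      have hyx : y = mk2 0 x := by rw [← heta, ← hzero]
      have hγ : Continuous fun t : ℝ => mk2 t x := continuous_mk2_left x
      have hne : mk2 0 x ≠ 0 := by rwa [← hyx]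
      have hne' : -(mk2 0 x) ≠ 0 := neg_ne_zero.2 hne
      have hk1 : ContinuousAt k (mk2 0 x) := hcont.continuousAt (isOpen_ne.mem_nhds hne)
      have hk2 : ContinuousAt k (-(mk2 0 x)) := hcont.continuousAt (isOpen_ne.mem_nhds hne')
      have hT1 : Tendsto (fun t : ℝ => (k (mk2 t x)).re) (𝓝[>] 0) (𝓝 ((k (mk2 0 x)).re)) := by
        have h0 : Tendsto (fun t : ℝ => mk2 t x) (𝓝 0) (𝓝 (mk2 0 x)) := hγ.tendsto 0
        exact ((Complex.continuous_re.tendsto _).comp (hk1.tendsto.comp h0)).mono_left nhdsWithin_le_nhds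
      have hT2 : Tendsto (fun t : ℝ => (k (-(mk2 t x))).re) (𝓝[>] 0) (𝓝 ((k (-(mk2 0 x))).re)) := by
        have h0 : Tendsto (fun t : ℝ => -(mk2 t x)) (𝓝 0) (𝓝 (-(mk2 0 x))) := hγ.neg.tendsto 0
        exact ((Complex.continuous_re.tendsto _).comp (hk2.tendsto.comp h0)).mono_left nhdsWithin_le_nhds
      have hEq : (fun t : ℝ => (k (-(mk2 t x))).re) =ᶠ[𝓝[>] 0] fun t => (k (mk2 t x)).re := by
        filter_upwards [self_mem_nhdsWithin] with t ht
        exact re_neg_of_pos hθ hLF (by simpa [mk2] using ht)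
      rw [hyx]
      exact tendsto_nhds_unique_of_eventuallyEq hT2 hT1 hEq
  · have hpos : 0 < (-y) 0 := by
      have : (-y) 0 = -(y 0) := rfl
      rw [this]; linarith
    have h := re_neg_of_pos hθ hLF hpos
    rw [neg_neg] at h
    exact h.symm

/-! ## Real reflection positivity from the complex representation -/

/-- **Reflection positivity of the real part** inside the plane: `Σ cᵢcⱼ Re k(θ₂yᵢ − yⱼ) = ∫ |Σ cᵢ e^{−tᵢE + i xᵢ p}|² dμ ≥ 0`. -/
theorem re_reflectionPositive (hθ : ∀ y, k (timeReflection 2 y) = k y)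
    (hLF : ∀ t : ℝ, 0 < t → Integrable (fun z : ℝ × ℝ => Real.exp (-(t * z.1))) μ ∧
      ∀ x : ℝ, k (mk2 t x) = ∫ z, ((Real.exp (-(z.1 * t)) : ℝ) : ℂ) * Complex.exp (((z.2 * x : ℝ) : ℂ) * Complex.I) ∂μ)
    (m : ℕ) (y : Fin m → E2) (c : Fin m → ℝ) (hy : ∀ i, 0 < y i 0) :
    0 ≤ ∑ i, ∑ j, c i * c j * (k (timeReflection 2 (y i) - y j)).re := by
  have hterm : ∀ i j, (k (timeReflection 2 (y i) - y j)).re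
      = ∫ z, Real.exp (-(z.1 * (y i 0 + y j 0))) * Real.cos (z.2 * (y i 1 - y j 1)) ∂μ := by
    intro i j
    rw [timeReflection_sub_eq, hθ, re_apply_mk2 hLF (add_pos (hy i) (hy j))]
  have hint : ∀ i j, Integrable
      (fun z : ℝ × ℝ => Real.exp (-(z.1 * (y i 0 + y j 0))) * Real.cos (z.2 * (y i 1 - y j 1))) μ := by
    intro i j
    have h0 := (hLF (y i 0 + y j 0) (add_pos (hy i) (hy j))).1
    refine (h0.congr (ae_of_all _ fun z => by rw [mul_comm])).mul_bdd (c := 1) (by fun_prop)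
      (ae_of_all _ fun z => ?_)
    rw [Real.norm_eq_abs]
    exact Real.abs_cos_le_one _
  simp_rw [hterm]
  have hstep : ∫ z, ∑ i, ∑ j, c i * c j * (Real.exp (-(z.1 * (y i 0 + y j 0))) * Real.cos (z.2 * (y i 1 - y j 1))) ∂μ
      = ∑ i, ∑ j, c i * c j * ∫ z, Real.exp (-(z.1 * (y i 0 + y j 0))) * Real.cos (z.2 * (y i 1 - y j 1)) ∂μ := by
    rw [integral_finsetSum _ (fun i _ => integrable_finsetSum _ (fun j _ => (hint i j).const_mul (c i * c j)))]
    refine Finset.sum_congr rfl fun i _ => ?_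
    rw [integral_finsetSum _ (fun j _ => (hint i j).const_mul (c i * c j))]
    refine Finset.sum_congr rfl fun j _ => ?_
    exact integral_const_mul _ _
  rw [← hstep]
  refine integral_nonneg fun z => ?_
  have hpt : ∑ i, ∑ j, c i * c j * (Real.exp (-(z.1 * (y i 0 + y j 0))) * Real.cos (z.2 * (y i 1 - y j 1)))
      = (∑ i, c i * Real.exp (-(z.1 * y i 0)) * Real.cos (z.2 * y i 1)) ^ 2
        + (∑ i, c i * Real.exp (-(z.1 * y i 0)) * Real.sin (z.2 * y i 1)) ^ 2 := by
    rw [sq, sq, Finset.sum_mul_sum, Finset.sum_mul_sum, ← Finset.sum_add_distrib]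
    refine Finset.sum_congr rfl fun i _ => ?_
    rw [← Finset.sum_add_distrib]
    refine Finset.sum_congr rfl fun j _ => ?_
    have he : Real.exp (-(z.1 * (y i 0 + y j 0))) = Real.exp (-(z.1 * y i 0)) * Real.exp (-(z.1 * y j 0)) := by
      rw [← Real.exp_add]; ring_nf
    rw [he, mul_sub, Real.cos_sub]
    ring
  simp only [Pi.zero_apply]
  rw [hpt]
  positivity

/-! ## The budget and the class -/

/-- The planar budget passes to the real part: `‖y‖⁶ Re k y → 0`. -/
theorem re_budget (h : Tendsto (fun y : E2 => ‖y‖ ^ 6 * ‖k y‖) (𝓝[≠] 0) (𝓝 0)) :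
    Tendsto (fun y : E2 => ‖y‖ ^ 6 * (k y).re) (𝓝[≠] 0) (𝓝 0) := by
  refine squeeze_zero_norm (fun y => ?_) h
  rw [norm_mul, norm_pow, norm_norm, Real.norm_eq_abs]
  gcongr
  exact Complex.abs_re_le_norm _

/-- **`Re ∘ k` is a kernel of the real planar class** ✓`InPlanarClass`. -/
theorem re_inPlanarClass (hcont : ContinuousOn k {y | y ≠ 0}) (hbd : ∃ C : ℝ, ∀ y, 1 ≤ ‖y‖ → ‖k y‖ ≤ C)
    (hθ : ∀ y, k (timeReflection 2 y) = k y) (hhex : ∀ y, k (hexReflection y) = k y)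
    (hLF : ∀ t : ℝ, 0 < t → Integrable (fun z : ℝ × ℝ => Real.exp (-(t * z.1))) μ ∧
      ∀ x : ℝ, k (mk2 t x) = ∫ z, ((Real.exp (-(z.1 * t)) : ℝ) : ℂ) * Complex.exp (((z.2 * x : ℝ) : ℂ) * Complex.I) ∂μ)
    (hbudget : Tendsto (fun y : E2 => ‖y‖ ^ 6 * ‖k y‖) (𝓝[≠] 0) (𝓝 0)) :
    InPlanarClass (fun y => (k y).re) := by
  refine ⟨?_, ?_, ?_, ?_, ?_, ?_, ?_⟩
  · exact Complex.continuous_re.comp_continuousOn hcont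
  · obtain ⟨C, hC⟩ := hbd
    exact ⟨C, fun y hy => (Complex.abs_re_le_norm _).trans (hC y hy)⟩
  · intro y
    show (k (timeReflection 2 y)).re = (k y).re
    rw [hθ y]
  · intro y
    show (k (hexReflection y)).re = (k y).re
    rw [hhex y]
  · intro y
    exact re_neg hcont hθ hLF y
  · intro m y c hy
    exact re_reflectionPositive hθ hLF m y c hy
  · exact re_budget hbudget

/-! ## The rung -/

/-- **Aperture `1` for Hermitian planar kernels**, hypotheses listed: ✓`planarConeSupport_holds` applied to `Re ∘ k` and the same `μ`. -/
theorem hasAperture_one_of_hermitian (k : E2 → ℂ) (μ : Measure (ℝ × ℝ))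
    (hcont : ContinuousOn k {y | y ≠ 0}) (hbd : ∃ C : ℝ, ∀ y, 1 ≤ ‖y‖ → ‖k y‖ ≤ C)
    (hθ : ∀ y, k (timeReflection 2 y) = k y) (hhex : ∀ y, k (hexReflection y) = k y)
    (hbudget : Tendsto (fun y : E2 => ‖y‖ ^ 6 * ‖k y‖) (𝓝[≠] 0) (𝓝 0))
    (hμ0 : μ (Set.Iio 0 ×ˢ Set.univ) = 0)
    (hLF : ∀ t : ℝ, 0 < t → Integrable (fun z : ℝ × ℝ => Real.exp (-(t * z.1))) μ ∧
      ∀ x : ℝ, k (mk2 t x) = ∫ z, ((Real.exp (-(z.1 * t)) : ℝ) : ℂ) * Complex.exp (((z.2 * x : ℝ) : ℂ) * Complex.I) ∂μ) :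
    HasAperture μ 1 :=
  planarConeSupport_holds _ μ (re_inPlanarClass hcont hbd hθ hhex hLF hbudget) (re_isPlanarLF hμ0 hLF)

/-- ★ **R1 «HERMITIAN CONE» (unfolded)**: with `InHermitianPlanarClass k` and `IsHermitianPlanarLF k μ` written out character-for-character,
`HasAperture μ 1`. -/
theorem hermitianCone_unfolded (k : E2 → ℂ) (μ : Measure (ℝ × ℝ))
    (hk : ContinuousOn k {y | y ≠ 0} ∧
      (∃ C : ℝ, ∀ y, 1 ≤ ‖y‖ → ‖k y‖ ≤ C) ∧
      (∀ y, k (timeReflection 2 y) = k y) ∧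
      (∀ y, k (hexReflection y) = k y) ∧
      (∃ μ : Measure (ℝ × ℝ), μ (Set.Iio 0 ×ˢ Set.univ) = 0 ∧
        ∀ t : ℝ, 0 < t → Integrable (fun z : ℝ × ℝ => Real.exp (-(t * z.1))) μ ∧
          ∀ x : ℝ, k (mk2 t x) = ∫ z, ((Real.exp (-(z.1 * t)) : ℝ) : ℂ) * Complex.exp (((z.2 * x : ℝ) : ℂ) * Complex.I) ∂μ) ∧
      Tendsto (fun y : E2 => ‖y‖ ^ 6 * ‖k y‖) (𝓝[≠] 0) (𝓝 0))
    (hμ : μ (Set.Iio 0 ×ˢ Set.univ) = 0 ∧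
      ∀ t : ℝ, 0 < t → Integrable (fun z : ℝ × ℝ => Real.exp (-(t * z.1))) μ ∧
        ∀ x : ℝ, k (mk2 t x) = ∫ z, ((Real.exp (-(z.1 * t)) : ℝ) : ℂ) * Complex.exp (((z.2 * x : ℝ) : ℂ) * Complex.I) ∂μ) :
    HasAperture μ 1 :=
  hasAperture_one_of_hermitian k μ hk.1 hk.2.1 hk.2.2.1 hk.2.2.2.1 hk.2.2.2.2.2 hμ.1 hμ.2

end Summit.QuantumFields.YangMills.Theorems.F4SubCurvatureDoorHermitianCone

end
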